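import Summits.AnomalousDissipation.AnomalousDissipation.Theorems.SoloBlindMomentumFluxLH
import Literature.Analysis.FluidPDE.DoeringFoiasProofs
import Literature.Analysis.FluidPDE.TimeAverageMeasureBasic
import Summits.AnomalousDissipation.AnomalousDissipation.Theorems.SoloBlindPowerFloor

/-!
# Solo (blind) — pinning of the in-phase flux in the long-time-average vocabulary of `ZerothLaw`

`ZerothLaw` measures energy and dissipation by `limsup`s of Cesàro means (`longTimeAvgSup`,
`timeMean`). Along every GLOBAL Leray–Hopf weak solution `u` of the Kolmogorov-forced system
(`f = kolForce = cos(2πx₃)e₁`, any viscosity `ν`, any momentum) whose slices have energy at most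
`R` (`∫‖u(t)‖² ≤ R`, `t > 0`, and `∫‖u₀‖² ≤ R`), with `M = √(1/2)√R`,
`A(t) = ∫u₃⟪g,u⟫ = ∫u₁u₃ sin(2πx₃)`, `W(t) = ∫⟪f,u(t)⟫` (injected power):

* `powerMean_eq`: `4π²ν ⟨W⟩_T = ½ − 2π ⟨A⟩_T − T⁻¹(W(T) − W(0))` for every window `T > 0`;
* `abs_inphaseMean_sub_le`: `|2π ⟨A⟩_T − ½| ≤ 4π²ν M + 2M T⁻¹`;
* `inphase_longTimeAvg_bounds`: `(½ − 4π²νM)/(2π) ≤ liminf_T ⟨A⟩_T ≤ limsup_T ⟨A⟩_T ≤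
  (½ + 4π²νM)/(2π)` — the in-phase flux of EVERY bounded-energy Leray–Hopf solution is pinned
  at `1/(4π)` up to `O(ν)`;
* `inphase_longTimeAvgInf_le_of_floor`: a dissipation floor UN-PINS it at order `ν`:
  `ε ≤ meanDissipation ν u` implies `liminf_T ⟨A⟩_T ≤ (½ − 4π²νε)/(2π) = 1/(4π) − 2πνε`
  (through the tree's `meanDissipation ≤ meanPower`, `DoeringFoias2002_dissipation_le_power_holds`);
* `meanPower_kolForce_eq_inphase` (exact): `meanPower f u = (½ − 2π · liminf_T ⟨A⟩_T)/(4π²ν)`, and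
  for global classical solutions `classical_meanDissipation_eq_inphase`:
  `2πν · meanDissipation ν u = 1/(4π) − liminf_T ⟨A⟩_T` — the dissipation IS the pinning defect;
* `zerothLaw_of_unpinned_classical_family` (the UN-PINNING DOOR): `ZerothLaw` follows from a
  family of bounded-energy classical solutions with `liminf_T ⟨A_j⟩_T ≤ 1/(4π) − 2πν_jε`.

So for the Kolmogorov force a `ZerothLaw` witness family with pointwise-bounded energy must
keep its in-phase Reynolds-stress moment below the universal value `1/(4π)` by a margin `≍ ν_j`
— exactly the order of the universal pinning error: the zeroth law for this force is a
statement about the sign-definite `O(ν)` defect of a pinned correlation, not about an `O(1)`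
quantity. [folklore; cite: Temam1984, Ch. III §1.1 (1.25); cite: MusacchioBoffetta2014, §2
eq. (2.4); cite: CheskidovDoeringPetrov2006, eq. (11)]
-/

open MeasureTheory Filter Topology Set UnitAddTorus
open scoped ENNReal NNReal InnerProductSpace

noncomputable section

namespace Summit.AnomalousDissipation.AnomalousDissipation.Theorems

open Literature.Analysis.FunctionSpaces Literature.Analysis.FunctionSpaces.Torus
open Literature.Analysis.FluidPDE

variable {ν : ℝ} {u₀ : UnitAddTorus (Fin 3) → EuclideanSpace ℝ (Fin 3)}
  {u : ℝ → UnitAddTorus (Fin 3) → EuclideanSpace ℝ (Fin 3)}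

/-- The Cesàro means `T ↦ T⁻¹ ∫₀ᵀ ∫ u₃⟪g,u⟫` of the in-phase flux moment
`A(t) = ∫ u₁u₃ sin(2πx₃)` (`timeMean` of `ZerothLaw`'s vocabulary). [folklore] -/
def inphaseMean (u : ℝ → UnitAddTorus (Fin 3) → EuclideanSpace ℝ (Fin 3)) : ℝ → ℝ :=
  timeMean fun t => ∫ x, u t x 2 * ⟪kolSin x, u t x⟫_ℝ

/-- The Cesàro means `T ↦ T⁻¹ ∫₀ᵀ ∫⟪f,u⟫` of the injected power (`meanPower f u` is their
`limsup`). [folklore] -/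
def powerMean (u : ℝ → UnitAddTorus (Fin 3) → EuclideanSpace ℝ (Fin 3)) : ℝ → ℝ :=
  timeMean fun t => ∫ x, ⟪kolForce x, u t x⟫_ℝ

/-- **Cesàro work identity** along a global Leray–Hopf solution of the Kolmogorov-forced
system: for every window `T > 0`,
`4π²ν · powerMean u T = ½ − 2π · inphaseMean u T − T⁻¹ (W(T) − W₀)`. [folklore] -/
theorem powerMean_eq (hu : Torus.IsGlobalLerayHopf ν (fun _ => kolForce) u₀ u) {T : ℝ}
    (hT : 0 < T) :
    4 * Real.pi ^ 2 * ν * powerMean u T =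
      1 / 2 - 2 * Real.pi * inphaseMean u T -
        T⁻¹ * ((∫ x, ⟪kolForce x, u T x⟫_ℝ) - ∫ x, ⟪kolForce x, u₀ x⟫_ℝ) := by
  have h := hu T hT
  have hA := integrableOn_Ioc_of_Ioo (lh_integrableOn_fluxMoment_sin h) le_rfl
  have hW := integrableOn_Ioc_of_Ioo (lh_integrableOn_pairing h isSmooth_kolForce) le_rfl
  have hII := lh_work_eq h hT ⟨hT, le_rfl⟩
  haveI : IsFiniteMeasure (volume.restrict (Ioc (0 : ℝ) T)) :=
    ⟨by rw [Measure.restrict_apply_univ]; exact measure_Ioc_lt_top⟩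
  have hhalf : IntegrableOn (fun _ : ℝ => (1 / 2 : ℝ)) (Ioc 0 T) := integrable_const _
  have i1 : IntegrableOn (fun s => 1 / 2 -
      2 * Real.pi * ∫ x, u s x 2 * ⟪kolSin x, u s x⟫_ℝ) (Ioc 0 T) := hhalf.sub (hA.const_mul _)
  rw [integral_sub i1 (hW.const_mul _), integral_sub hhalf (hA.const_mul _), integral_const_mul,
    integral_const_mul, setIntegral_const, Real.volume_real_Ioc_of_le hT.le, sub_zero,
    smul_eq_mul] at hII
  have hTinv : T⁻¹ * T = 1 := inv_mul_cancel₀ hT.ne'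
  unfold powerMean inphaseMean timeMean
  rw [intervalIntegral.integral_of_le hT.le, intervalIntegral.integral_of_le hT.le]
  linear_combination T⁻¹ * hII + (1 / 2 : ℝ) * hTinv

/-- **Cesàro pinning per window.** If `∫‖u₀‖² ≤ R` and `∫‖u(t)‖² ≤ R` for `t > 0`, then for
every `T > 0`: `|2π · inphaseMean u T − ½| ≤ 4π²ν √(1/2)√R + 2 √(1/2)√R · T⁻¹`. [folklore] -/
theorem abs_inphaseMean_sub_le (hu : Torus.IsGlobalLerayHopf ν (fun _ => kolForce) u₀ u)
    (hν : 0 ≤ ν) (hu₀ : MemLp u₀ 2 volume) {R : ℝ} (hR₀ : ∫ x, ‖u₀ x‖ ^ 2 ≤ R)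
    (hR : ∀ t, 0 < t → ∫ x, ‖u t x‖ ^ 2 ≤ R) {T : ℝ} (hT : 0 < T) :
    |2 * Real.pi * inphaseMean u T - 1 / 2| ≤
      4 * Real.pi ^ 2 * ν * (Real.sqrt (1 / 2) * Real.sqrt R) +
        2 * (Real.sqrt (1 / 2) * Real.sqrt R) * T⁻¹ := by
  have key := lh_abs_inphase_sub_le (hu T hT) hT hν hu₀ hR₀ (fun s hs => hR s hs.1)
    ⟨hT, le_rfl⟩
  have hTinv : T⁻¹ * T = 1 := inv_mul_cancel₀ hT.ne'
  unfold inphaseMean timeMean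
  rw [intervalIntegral.integral_of_le hT.le]
  have e : 2 * Real.pi * (T⁻¹ * ∫ s in Ioc 0 T, ∫ x, u s x 2 * ⟪kolSin x, u s x⟫_ℝ) - 1 / 2 =
      T⁻¹ * (2 * Real.pi * (∫ s in Ioc 0 T, ∫ x, u s x 2 * ⟪kolSin x, u s x⟫_ℝ) - T / 2) := by
    linear_combination (1 / 2 : ℝ) * hTinv
  rw [e, abs_mul, abs_of_pos (inv_pos.2 hT)]
  refine (mul_le_mul_of_nonneg_left key (inv_pos.2 hT).le).trans_eq ?_
  linear_combination (4 * Real.pi ^ 2 * ν * (Real.sqrt (1 / 2) * Real.sqrt R)) * hTinv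

/-- Eventual two-sided Cesàro pinning with slack `δ > 0`: for all large `T`,
`½ − 4π²νM − δ ≤ 2π · inphaseMean u T ≤ ½ + 4π²νM + δ`, `M = √(1/2)√R`. [folklore] -/
theorem eventually_inphaseMean_bounds
    (hu : Torus.IsGlobalLerayHopf ν (fun _ => kolForce) u₀ u) (hν : 0 ≤ ν)
    (hu₀ : MemLp u₀ 2 volume) {R : ℝ} (hR₀ : ∫ x, ‖u₀ x‖ ^ 2 ≤ R)
    (hR : ∀ t, 0 < t → ∫ x, ‖u t x‖ ^ 2 ≤ R) {δ : ℝ} (hδ : 0 < δ) :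
    ∀ᶠ T in atTop,
      2 * Real.pi * inphaseMean u T ≤
          1 / 2 + 4 * Real.pi ^ 2 * ν * (Real.sqrt (1 / 2) * Real.sqrt R) + δ ∧
        1 / 2 - 4 * Real.pi ^ 2 * ν * (Real.sqrt (1 / 2) * Real.sqrt R) - δ ≤
          2 * Real.pi * inphaseMean u T := by
  have hsmall : ∀ᶠ T : ℝ in atTop, 2 * (Real.sqrt (1 / 2) * Real.sqrt R) * T⁻¹ < δ := by
    have ht : Tendsto (fun T : ℝ => 2 * (Real.sqrt (1 / 2) * Real.sqrt R) * T⁻¹) atTop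
        (𝓝 (2 * (Real.sqrt (1 / 2) * Real.sqrt R) * 0)) :=
      tendsto_inv_atTop_zero.const_mul _
    rw [mul_zero] at ht
    exact (tendsto_order.1 ht).2 δ hδ
  filter_upwards [hsmall, eventually_gt_atTop (0 : ℝ)] with T h1 h2
  obtain ⟨k1, k2⟩ := abs_le.1 (abs_inphaseMean_sub_le hu hν hu₀ hR₀ hR h2)
  constructor <;> linarith

/-- **Pinning of the in-phase flux in `ZerothLaw`'s vocabulary.** Along every global
Leray–Hopf weak solution of the Kolmogorov-forced system with `∫‖u₀‖² ≤ R`, `∫‖u(t)‖² ≤ R`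
(`t > 0`): `(½ − 4π²ν√(1/2)√R)/(2π) ≤ longTimeAvgInf A` and
`longTimeAvgSup A ≤ (½ + 4π²ν√(1/2)√R)/(2π)`, `A(t) = ∫ u₃⟪g,u⟫ = ∫ u₁u₃ sin(2πx₃)`: the
long-time in-phase Reynolds-stress moment of every bounded-energy solution is `1/(4π) + O(ν)`,
at any viscosity and any momentum. [folklore; cite: MusacchioBoffetta2014, §2 eq. (2.4)] -/
theorem inphase_longTimeAvg_bounds (hu : Torus.IsGlobalLerayHopf ν (fun _ => kolForce) u₀ u)
    (hν : 0 ≤ ν) (hu₀ : MemLp u₀ 2 volume) {R : ℝ} (hR₀ : ∫ x, ‖u₀ x‖ ^ 2 ≤ R)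
    (hR : ∀ t, 0 < t → ∫ x, ‖u t x‖ ^ 2 ≤ R) :
    (1 / 2 - 4 * Real.pi ^ 2 * ν * (Real.sqrt (1 / 2) * Real.sqrt R)) / (2 * Real.pi) ≤
        longTimeAvgInf (fun t => ∫ x, u t x 2 * ⟪kolSin x, u t x⟫_ℝ) ∧
      longTimeAvgSup (fun t => ∫ x, u t x 2 * ⟪kolSin x, u t x⟫_ℝ) ≤
        (1 / 2 + 4 * Real.pi ^ 2 * ν * (Real.sqrt (1 / 2) * Real.sqrt R)) / (2 * Real.pi) := by
  change (1 / 2 - 4 * Real.pi ^ 2 * ν * (Real.sqrt (1 / 2) * Real.sqrt R)) / (2 * Real.pi) ≤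
        liminf (inphaseMean u) atTop ∧
      limsup (inphaseMean u) atTop ≤
        (1 / 2 + 4 * Real.pi ^ 2 * ν * (Real.sqrt (1 / 2) * Real.sqrt R)) / (2 * Real.pi)
  have hπ : 0 < 2 * Real.pi := by positivity
  have hev := fun δ (hδ : (0 : ℝ) < δ) => eventually_inphaseMean_bounds hu hν hu₀ hR₀ hR hδ
  have hlow : ∀ᶠ T in atTop,
      (1 / 2 - 4 * Real.pi ^ 2 * ν * (Real.sqrt (1 / 2) * Real.sqrt R) - 1) / (2 * Real.pi) ≤
        inphaseMean u T := by
    filter_upwards [hev 1 one_pos] with T hT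
    rw [div_le_iff₀ hπ]
    linarith [hT.2]
  have hup : ∀ᶠ T in atTop, inphaseMean u T ≤
      (1 / 2 + 4 * Real.pi ^ 2 * ν * (Real.sqrt (1 / 2) * Real.sqrt R) + 1) / (2 * Real.pi) := by
    filter_upwards [hev 1 one_pos] with T hT
    rw [le_div_iff₀ hπ]
    linarith [hT.1]
  constructor
  · refine le_of_forall_pos_le_add fun ε hε => ?_
    have hlim : (1 / 2 - 4 * Real.pi ^ 2 * ν * (Real.sqrt (1 / 2) * Real.sqrt R)) /
        (2 * Real.pi) - ε ≤ liminf (inphaseMean u) atTop := by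
      refine le_liminf_of_le (isCoboundedUnder_ge_of_eventually_le atTop hup) ?_
      filter_upwards [hev (2 * Real.pi * ε) (by positivity)] with T hT
      calc (1 / 2 - 4 * Real.pi ^ 2 * ν * (Real.sqrt (1 / 2) * Real.sqrt R)) / (2 * Real.pi) - ε
          = (1 / 2 - 4 * Real.pi ^ 2 * ν * (Real.sqrt (1 / 2) * Real.sqrt R) -
              2 * Real.pi * ε) / (2 * Real.pi) := by
            rw [sub_div _ (2 * Real.pi * ε), mul_div_cancel_left₀ ε hπ.ne']
        _ ≤ inphaseMean u T := (div_le_iff₀ hπ).2 (by linarith [hT.2])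
    linarith
  · refine le_of_forall_pos_le_add fun ε hε => ?_
    refine limsup_le_of_le (isCoboundedUnder_le_of_eventually_le atTop hlow) ?_
    filter_upwards [hev (2 * Real.pi * ε) (by positivity)] with T hT
    calc inphaseMean u T ≤ (1 / 2 + 4 * Real.pi ^ 2 * ν * (Real.sqrt (1 / 2) * Real.sqrt R) +
          2 * Real.pi * ε) / (2 * Real.pi) := (le_div_iff₀ hπ).2 (by linarith [hT.1])
      _ = (1 / 2 + 4 * Real.pi ^ 2 * ν * (Real.sqrt (1 / 2) * Real.sqrt R)) / (2 * Real.pi) +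
          ε := by
          rw [add_div _ (2 * Real.pi * ε), mul_div_cancel_left₀ ε hπ.ne']

/-- **A dissipation floor un-pins the in-phase flux at order `ν`.** Along every global
Leray–Hopf weak solution of the Kolmogorov-forced system with `ν > 0`, `∫‖u₀‖² ≤ R` and
`∫‖u(t)‖² ≤ R` (`t > 0`): if `ε ≤ meanDissipation ν u` (the `ZerothLaw` floor quantity) then
`longTimeAvgInf A ≤ (½ − 4π²νε)/(2π) = 1/(4π) − 2πνε`. With `inphase_longTimeAvg_bounds`
(`longTimeAvgInf A ≥ 1/(4π) − 2πν√(1/2)√R`) this exhibits the zeroth law for the Kolmogorov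
force as a statement about the `O(ν)` defect of a universally pinned correlation. Uses the
tree's `meanDissipation ≤ meanPower` for Leray–Hopf solutions
(`DoeringFoias2002_dissipation_le_power_holds`). [folklore; cite: CheskidovDoeringPetrov2006,
eq. (11)] -/
theorem inphase_longTimeAvgInf_le_of_floor
    (hu : Torus.IsGlobalLerayHopf ν (fun _ => kolForce) u₀ u) (hν : 0 < ν)
    (hu₀ : MemLp u₀ 2 volume) {R : ℝ} (hR₀ : ∫ x, ‖u₀ x‖ ^ 2 ≤ R)
    (hR : ∀ t, 0 < t → ∫ x, ‖u t x‖ ^ 2 ≤ R) {ε : ℝ} (hε : ε ≤ meanDissipation ν u) :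
    longTimeAvgInf (fun t => ∫ x, u t x 2 * ⟪kolSin x, u t x⟫_ℝ) ≤
      (1 / 2 - 4 * Real.pi ^ 2 * ν * ε) / (2 * Real.pi) := by
  change liminf (inphaseMean u) atTop ≤ _
  have hπ : 0 < 2 * Real.pi := by positivity
  have h4 : 0 < 4 * Real.pi ^ 2 * ν := by positivity
  -- the floor is below the mean power
  have hP : ε ≤ limsup (powerMean u) atTop := by
    have h := hε.trans (DoeringFoias2002_dissipation_le_power_holds hν
      (isSmooth_kolForce.memLp 2) hasZeroMean_kolForce u₀ u hu)
    unfold meanPower longTimeAvgSup at h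
    exact h
  -- pointwise bounds on the power and on its Cesàro means
  have hWt : ∀ t, 0 < t → |∫ x, ⟪kolForce x, u t x⟫_ℝ| ≤ Real.sqrt (1 / 2) * Real.sqrt R :=
    fun t ht => (abs_work_le_L2 ((hu t ht).memLp t ⟨ht.le, le_rfl⟩)).trans
      (mul_le_mul_of_nonneg_left (Real.sqrt_le_sqrt (hR t ht)) (Real.sqrt_nonneg _))
  have hW0 : |∫ x, ⟪kolForce x, u₀ x⟫_ℝ| ≤ Real.sqrt (1 / 2) * Real.sqrt R :=
    (abs_work_le_L2 hu₀).trans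
      (mul_le_mul_of_nonneg_left (Real.sqrt_le_sqrt hR₀) (Real.sqrt_nonneg _))
  have hcoW : IsCoboundedUnder (· ≤ ·) atTop (powerMean u) := by
    refine isCoboundedUnder_le_of_eventually_le atTop
      (x := -(Real.sqrt (1 / 2) * Real.sqrt R)) ?_
    filter_upwards [eventually_gt_atTop (0 : ℝ)] with T hT
    exact (abs_le.1 (abs_timeMean_le hT fun t ht _ => hWt t ht)).1
  have hbddA : IsBoundedUnder (· ≥ ·) atTop (inphaseMean u) := by
    refine isBoundedUnder_of_eventually_ge
      (a := (1 / 2 - 4 * Real.pi ^ 2 * ν * (Real.sqrt (1 / 2) * Real.sqrt R) - 1) /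
        (2 * Real.pi)) ?_
    filter_upwards [eventually_inphaseMean_bounds hu hν.le hu₀ hR₀ hR one_pos] with T hT
    rw [div_le_iff₀ hπ]
    linarith [hT.2]
  refine le_of_forall_pos_le_add fun δ hδ => ?_
  -- slack: `η` in the power, `πδ` in the boundary term
  obtain ⟨η, hη0, hη⟩ : ∃ η : ℝ, 0 < η ∧ 4 * Real.pi ^ 2 * ν * η = Real.pi * δ :=
    ⟨Real.pi * δ / (4 * Real.pi ^ 2 * ν), by positivity, mul_div_cancel₀ _ h4.ne'⟩
  have hsmall : ∀ᶠ T : ℝ in atTop, 2 * (Real.sqrt (1 / 2) * Real.sqrt R) * T⁻¹ < Real.pi * δ := by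
    have ht : Tendsto (fun T : ℝ => 2 * (Real.sqrt (1 / 2) * Real.sqrt R) * T⁻¹) atTop
        (𝓝 (2 * (Real.sqrt (1 / 2) * Real.sqrt R) * 0)) :=
      tendsto_inv_atTop_zero.const_mul _
    rw [mul_zero] at ht
    exact (tendsto_order.1 ht).2 _ (by positivity)
  have hfreq : ∃ᶠ T in atTop, ε - η < powerMean u T :=
    frequently_lt_of_lt_limsup hcoW (by linarith)
  refine liminf_le_of_frequently_le ((hfreq.and_eventually
    (hsmall.and (eventually_gt_atTop (0 : ℝ)))).mono fun T hT => ?_) hbddA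
  obtain ⟨hmW, hsm, hT0⟩ := hT
  have e := powerMean_eq hu hT0
  obtain ⟨a1, a2⟩ := abs_le.1 (hWt T hT0)
  obtain ⟨b1, b2⟩ := abs_le.1 hW0
  have p1 : T⁻¹ * -((∫ x, ⟪kolForce x, u T x⟫_ℝ) - ∫ x, ⟪kolForce x, u₀ x⟫_ℝ) ≤
      T⁻¹ * (2 * (Real.sqrt (1 / 2) * Real.sqrt R)) :=
    mul_le_mul_of_nonneg_left (by linarith) (inv_pos.2 hT0).le
  have p2 : 4 * Real.pi ^ 2 * ν * (ε - η) < 4 * Real.pi ^ 2 * ν * powerMean u T :=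
    mul_lt_mul_of_pos_left hmW h4
  calc inphaseMean u T
      ≤ (1 / 2 - 4 * Real.pi ^ 2 * ν * ε + 2 * Real.pi * δ) / (2 * Real.pi) :=
        (le_div_iff₀ hπ).2 (by linarith)
    _ = (1 / 2 - 4 * Real.pi ^ 2 * ν * ε) / (2 * Real.pi) + δ := by
        rw [add_div _ (2 * Real.pi * δ), mul_div_cancel_left₀ δ hπ.ne']

/-- **The mean injected power is read off the in-phase flux (exact).** Along every global
Leray–Hopf weak solution of the Kolmogorov-forced system with `ν > 0`, `∫‖u₀‖² ≤ R` and
`∫‖u(t)‖² ≤ R` (`t > 0`):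
`meanPower f u = (½ − 2π · longTimeAvgInf A)/(4π²ν)`, `A(t) = ∫ u₁u₃ sin(2πx₃)` — the `limsup`
Cesàro power of `ZerothLaw`'s dissipation bound `meanDissipation ≤ meanPower` is an affine image of
the `liminf` Cesàro in-phase Reynolds-stress moment. [folklore] -/
theorem meanPower_kolForce_eq_inphase
    (hu : Torus.IsGlobalLerayHopf ν (fun _ => kolForce) u₀ u) (hν : 0 < ν)
    (hu₀ : MemLp u₀ 2 volume) {R : ℝ} (hR₀ : ∫ x, ‖u₀ x‖ ^ 2 ≤ R)
    (hR : ∀ t, 0 < t → ∫ x, ‖u t x‖ ^ 2 ≤ R) :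
    meanPower kolForce u =
      (1 / 2 - 2 * Real.pi * longTimeAvgInf (fun t => ∫ x, u t x 2 * ⟪kolSin x, u t x⟫_ℝ)) /
        (4 * Real.pi ^ 2 * ν) := by
  change limsup (powerMean u) atTop =
    (1 / 2 - 2 * Real.pi * liminf (inphaseMean u) atTop) / (4 * Real.pi ^ 2 * ν)
  have hπ : 0 < 2 * Real.pi := by positivity
  have h4 : 0 < 4 * Real.pi ^ 2 * ν := by positivity
  -- the affine antitone read-out map
  set φ : ℝ → ℝ := fun a => (1 / 2 - 2 * Real.pi * a) / (4 * Real.pi ^ 2 * ν) with hφdef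
  have hφ : Antitone φ := fun a b hab =>
    div_le_div_of_nonneg_right (by linarith [mul_le_mul_of_nonneg_left hab hπ.le]) h4.le
  have hφc : Continuous φ := (continuous_const.sub (continuous_const.mul continuous_id)).div_const _
  -- two-sided eventual bounds on the in-phase means
  have hev := eventually_inphaseMean_bounds hu hν.le hu₀ hR₀ hR one_pos
  have hbA : IsBoundedUnder (· ≤ ·) atTop (inphaseMean u) := by
    refine isBoundedUnder_of_eventually_le
      (a := (1 / 2 + 4 * Real.pi ^ 2 * ν * (Real.sqrt (1 / 2) * Real.sqrt R) + 1) /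
        (2 * Real.pi)) ?_
    filter_upwards [hev] with T hT
    rw [le_div_iff₀ hπ]
    linarith [hT.1]
  have hbA' : IsBoundedUnder (· ≥ ·) atTop (inphaseMean u) := by
    refine isBoundedUnder_of_eventually_ge
      (a := (1 / 2 - 4 * Real.pi ^ 2 * ν * (Real.sqrt (1 / 2) * Real.sqrt R) - 1) /
        (2 * Real.pi)) ?_
    filter_upwards [hev] with T hT
    rw [div_le_iff₀ hπ]
    linarith [hT.2]
  have hbφ : IsBoundedUnder (· ≤ ·) atTop (fun T => φ (inphaseMean u T)) := by
    obtain ⟨a, ha⟩ := hbA'.eventually_ge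
    exact isBoundedUnder_of_eventually_le (ha.mono fun T h => hφ h)
  have hbφ' : IsBoundedUnder (· ≥ ·) atTop (fun T => φ (inphaseMean u T)) := by
    obtain ⟨a, ha⟩ := hbA.eventually_le
    exact isBoundedUnder_of_eventually_ge (ha.mono fun T h => hφ h)
  -- the boundary remainder tends to zero
  have hWt : ∀ t, 0 < t → |∫ x, ⟪kolForce x, u t x⟫_ℝ| ≤ Real.sqrt (1 / 2) * Real.sqrt R :=
    fun t ht => (abs_work_le_L2 ((hu t ht).memLp t ⟨ht.le, le_rfl⟩)).trans
      (mul_le_mul_of_nonneg_left (Real.sqrt_le_sqrt (hR t ht)) (Real.sqrt_nonneg _))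
  have hW0 : |∫ x, ⟪kolForce x, u₀ x⟫_ℝ| ≤ Real.sqrt (1 / 2) * Real.sqrt R :=
    (abs_work_le_L2 hu₀).trans
      (mul_le_mul_of_nonneg_left (Real.sqrt_le_sqrt hR₀) (Real.sqrt_nonneg _))
  set r : ℝ → ℝ := fun T =>
    -(T⁻¹ * ((∫ x, ⟪kolForce x, u T x⟫_ℝ) - ∫ x, ⟪kolForce x, u₀ x⟫_ℝ)) /
      (4 * Real.pi ^ 2 * ν) with hrdef
  have hr : Tendsto r atTop (𝓝 0) := by
    have ht : Tendsto (fun T : ℝ => 2 * (Real.sqrt (1 / 2) * Real.sqrt R) /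
        (4 * Real.pi ^ 2 * ν) * T⁻¹) atTop
        (𝓝 (2 * (Real.sqrt (1 / 2) * Real.sqrt R) / (4 * Real.pi ^ 2 * ν) * 0)) :=
      tendsto_inv_atTop_zero.const_mul _
    rw [mul_zero] at ht
    refine squeeze_zero_norm' ?_ ht
    filter_upwards [eventually_gt_atTop (0 : ℝ)] with T hT
    obtain ⟨a1, a2⟩ := abs_le.1 (hWt T hT)
    obtain ⟨b1, b2⟩ := abs_le.1 hW0
    rw [hrdef, Real.norm_eq_abs, abs_div, abs_neg, abs_mul, abs_of_pos (inv_pos.2 hT),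
      abs_of_pos h4, div_le_iff₀ h4]
    have e : 2 * (Real.sqrt (1 / 2) * Real.sqrt R) / (4 * Real.pi ^ 2 * ν) * T⁻¹ *
        (4 * Real.pi ^ 2 * ν) = T⁻¹ * (2 * (Real.sqrt (1 / 2) * Real.sqrt R)) := by
      field_simp
    rw [e]
    exact mul_le_mul_of_nonneg_left (abs_le.2 ⟨by linarith, by linarith⟩) (inv_pos.2 hT).le
  -- decomposition of the power means
  have hdec : powerMean u =ᶠ[atTop] fun T => φ (inphaseMean u T) + r T := by
    filter_upwards [eventually_gt_atTop (0 : ℝ)] with T hT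
    have e := powerMean_eq hu hT
    simp only [hφdef, hrdef]
    rw [← add_div, eq_div_iff h4.ne']
    linarith
  rw [limsup_congr hdec]
  -- the remainder does not move the limsup
  have h1 : limsup (fun T => φ (inphaseMean u T) + r T) atTop ≤
      limsup (fun T => φ (inphaseMean u T)) atTop + limsup r atTop :=
    limsup_add_le hbφ' hbφ hr.isBoundedUnder_ge.isCoboundedUnder_le hr.isBoundedUnder_le
  have h2 : limsup (fun T => φ (inphaseMean u T)) atTop + liminf r atTop ≤
      limsup (fun T => φ (inphaseMean u T) + r T) atTop :=
    le_limsup_add hbφ hbφ'.isCoboundedUnder_le hr.isBoundedUnder_le hr.isBoundedUnder_ge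
  rw [hr.limsup_eq, add_zero] at h1
  rw [hr.liminf_eq, add_zero] at h2
  rw [le_antisymm h1 h2]
  -- antitone continuous read-out: `limsup (φ ∘ A) = φ (liminf A)`
  have hanti := hφ.map_liminf_of_continuousAt (inphaseMean u) hφc.continuousAt
    hbA.isCoboundedUnder_ge hbA'
  exact hanti.symm

/-- **Classical form: the dissipation IS the pinning defect.** For every global classical
solution `(u, p)` of the Kolmogorov-forced Navier–Stokes system (`ν > 0`) with
`∫‖u(t)‖² ≤ R` for `t ≥ 0`:
`meanDissipation ν u = (½ − 2π · longTimeAvgInf A)/(4π²ν)`, i.e.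
`2πν · meanDissipation ν u = 1/(4π) − liminf_T ⟨∫ u₁u₃ sin(2πx₃)⟩_T`. Hence `ZerothLaw` for this
force, restricted to classical families bounded in `L∞ₜL²ₓ`, is exactly the statement that the
pinning defect of the in-phase flux is `≥ 2πν_j ε` along the family (energy equality through
`classical_meanDissipation_eq_meanPower`). [folklore] -/
theorem classical_meanDissipation_eq_inphase {p : ℝ → UnitAddTorus (Fin 3) → ℝ}
    (h : Torus.IsClassicalNSSolutionOn univ ν (fun _ => kolForce) u p) (hν : 0 < ν) {R : ℝ}
    (hR : ∀ t, 0 ≤ t → ∫ x, ‖u t x‖ ^ 2 ≤ R) :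
    meanDissipation ν u =
      (1 / 2 - 2 * Real.pi * longTimeAvgInf (fun t => ∫ x, u t x 2 * ⟪kolSin x, u t x⟫_ℝ)) /
        (4 * Real.pi ^ 2 * ν) := by
  rw [classical_meanDissipation_eq_meanPower h isSmooth_kolForce ⟨R, hR⟩]
  exact meanPower_kolForce_eq_inphase h.isGlobalLerayHopf hν
    ((h.smooth_velocity.isSmooth_slice (mem_univ 0)).memLp 2) (hR 0 le_rfl) fun t ht => hR t ht.le

/-- **The un-pinning door to `ZerothLaw`.** On the Kolmogorov force the summit statement follows
from an UN-PINNING statement about one quadratic velocity moment, with no gradient, dissipation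
or fine-scale quantity in the hypothesis: if global classical solutions `u_j` of
`NS_{ν_j}(kolForce)` (`ν_j > 0`, `ν_j → 0`; pointwise-bounded energy for each `j`, any bound;
mean energies `≤ E`) satisfy `liminf_T ⟨∫ u₁u₃ sin(2πx₃)⟩_T ≤ 1/(4π) − 2πν_j ε` for one `ε > 0`
and all `j`, then `ZerothLaw` holds, witnessed by `kolForce`, `u_j(0)`, `u_j`
(`classical_meanDissipation_eq_inphase` turns the margin into `meanDissipation ≥ ε`). For such
families the converse holds too (`inphase_longTimeAvgInf_le_of_floor`), so this is an exact
reformulation of the zeroth law on its natural classical witness class. [folklore] -/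
theorem zerothLaw_of_unpinned_classical_family {νs : ℕ → ℝ}
    {us : ℕ → ℝ → UnitAddTorus (Fin 3) → EuclideanSpace ℝ (Fin 3)}
    {ps : ℕ → ℝ → UnitAddTorus (Fin 3) → ℝ}
    (hν : ∀ j, 0 < νs j) (hν0 : Tendsto νs atTop (𝓝 0))
    (hcl : ∀ j, Torus.IsClassicalNSSolutionOn univ (νs j) (fun _ => kolForce) (us j) (ps j))
    (hb : ∀ j, ∃ R : ℝ, ∀ t, 0 ≤ t → ∫ x, ‖us j t x‖ ^ 2 ≤ R)
    (hE : ∃ E : ℝ, ∀ j, meanEnergy (us j) ≤ E) {ε : ℝ} (hε : 0 < ε)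
    (hA : ∀ j, longTimeAvgInf (fun t => ∫ x, us j t x 2 * ⟪kolSin x, us j t x⟫_ℝ) ≤
      (1 / 2 - 4 * Real.pi ^ 2 * νs j * ε) / (2 * Real.pi)) :
    Literature.Turb.ZerothLaw := by
  refine ⟨kolForce, isSmooth_kolForce, isDivFree_kolForce, hasZeroMean_kolForce, νs,
    fun j => us j 0, us, hν, hν0, fun j => (hcl j).isGlobalLerayHopf, hE, ε, hε, fun j => ?_⟩
  obtain ⟨R, hR⟩ := hb j
  have hνj := hν j
  have hπ : 0 < 2 * Real.pi := by positivity
  have h4 : 0 < 4 * Real.pi ^ 2 * νs j := by positivity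
  have hAj := hA j
  rw [le_div_iff₀ hπ] at hAj
  rw [classical_meanDissipation_eq_inphase (hcl j) hνj hR, le_div_iff₀ h4]
  linarith

end Summit.AnomalousDissipation.AnomalousDissipation.Theorems
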